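import Summits.CriticalPhenomena.CardyFormulaZ2.Theorems.CardyRotToConfR2SymmetryUpgrade.Negative.SurgFatFamily
import Summits.CriticalPhenomena.CardyFormulaZ2.Theorems.CardyRotToConfR2SymmetryUpgrade.Negative.SurgConcatHit
import Summits.CriticalPhenomena.CardyFormulaZ2.Theorems.CardyRotToConfR2SymmetryUpgrade.Negative.SurgStopAtMeasurable
import Mathlib.MeasureTheory.Integral.Lebesgue.Map
import HarnessLib

/-!
# Transfer of set lower integrals along the surgery prefixing map
# (crux `CardyRotToConfR2SymmetryUpgrade`, stmt-CriticalPhenomena-0698, line germ-label-transport)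

In the Markov identity for the surgery law `J D = (S E).map (firePrefix D)` the right-hand side is a
lower integral of a NON-measurable kernel against a push-forward. We pull it back along
`π := firePrefix D`: for EVERY (not necessarily measurable) `g : CurveClass ℂ → ℝ≥0∞` and measurable
`T`,
`∫⁻ γ in T, g γ ∂(μ.map π) = ∫⁻ ξ in π ⁻¹' T, g (π ξ) ∂μ`
whenever `μ`-a.e. `ξ.source = firePt D` (and the germ of `D` at `a` fires). The point is that `π`
has a MEASURABLE LEFT INVERSE on the classes starting at the landing point `q = firePt D`, namely
`CurveClass.startFrom {q}` (the chord visits `q` only at its final parameter), and a measurable map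
with a measurable a.e. left inverse transfers lower integrals of arbitrary integrands
(`lintegral_map_le` in both directions).

Main statements: `lintegral_map_eq_of_ae_leftInverse`, `setLIntegral_map_eq_of_ae_leftInverse`
(pure measure theory), `startFrom_singleton_firePrefix` (the left inverse), and the registered
stub `stub_fatSurgeryMarkovTransfer`. Negative lane: no Theses statement is asserted.
-/

noncomputable section

open Set Filter Topology MeasureTheory
open scoped unitInterval ENNReal

namespace Summit.CriticalPhenomena.CardyFormulaZ2.Theorems.CardyRotToConfR2SymmetryUpgrade

open Literature.Probability.RandomPlanarGeometry
open Literature.Probability.RandomPlanarGeometry.BrownianLoop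
open Summit.CriticalPhenomena.CardyFormulaZ2.Theorems.CardyRotToConfR2SymmetryUpgrade.Negative

/-! ### A measurable map with a measurable a.e. left inverse transfers all lower integrals -/

section Transfer

variable {α β : Type*} [MeasurableSpace α] [MeasurableSpace β] [MeasurableEq β]
  {π : α → β} {L : β → α} {μ : Measure α}

/-- **Transfer of lower integrals of arbitrary integrands.** If `π` is measurable and has a
measurable `μ`-a.e. left inverse `L`, then `∫⁻ y, g y ∂(μ.map π) = ∫⁻ x, g (π x) ∂μ` for EVERY
`g : β → ℝ≥0∞` (no measurability of `g`): `≤` is `lintegral_map_le`; for `≥`, `μ = (μ.map π).map L`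
and `lintegral_map_le` along `L`, using that `π ∘ L = id` holds `μ.map π`-a.e. [folklore] -/
theorem lintegral_map_eq_of_ae_leftInverse (hπ : Measurable π) (hL : Measurable L)
    (h : ∀ᵐ x ∂μ, L (π x) = x) (g : β → ℝ≥0∞) :
    ∫⁻ y, g y ∂(μ.map π) = ∫⁻ x, g (π x) ∂μ := by
  refine le_antisymm (lintegral_map_le g π) ?_
  -- `μ.map π`-a.e. `π (L y) = y`
  have hfix : ∀ᵐ y ∂(μ.map π), π (L y) = y := by
    refine (ae_map_iff hπ.aemeasurable ?_).2 ?_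
    · exact measurableSet_eq_fun (hπ.comp hL) measurable_id
    · filter_upwards [h] with x hx
      rw [hx]
  -- `μ` is the push-forward of `μ.map π` along `L`
  have hμ : (μ.map π).map L = μ := by
    rw [Measure.map_map hL hπ]
    calc μ.map (L ∘ π) = μ.map id := Measure.map_congr (h.mono fun x hx => hx)
      _ = μ := Measure.map_id
  calc ∫⁻ x, g (π x) ∂μ = ∫⁻ x, g (π x) ∂((μ.map π).map L) := by rw [hμ]
    _ ≤ ∫⁻ y, g (π (L y)) ∂(μ.map π) := lintegral_map_le (fun x => g (π x)) L
    _ = ∫⁻ y, g y ∂(μ.map π) := lintegral_congr_ae (hfix.mono fun y hy => by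
        show g (π (L y)) = g y
        rw [hy])

/-- **Transfer of SET lower integrals of arbitrary integrands** along a measurable map with a
measurable a.e. left inverse: `∫⁻ y in T, g y ∂(μ.map π) = ∫⁻ x in π ⁻¹' T, g (π x) ∂μ` for
measurable `T` and EVERY `g`. [folklore] -/
theorem setLIntegral_map_eq_of_ae_leftInverse (hπ : Measurable π) (hL : Measurable L)
    (h : ∀ᵐ x ∂μ, L (π x) = x) (g : β → ℝ≥0∞) {T : Set β} (hT : MeasurableSet T) :
    ∫⁻ y in T, g y ∂(μ.map π) = ∫⁻ x in π ⁻¹' T, g (π x) ∂μ := by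
  rw [Measure.restrict_map hπ hT]
  exact lintegral_map_eq_of_ae_leftInverse hπ hL (ae_restrict_of_ae h) g

end Transfer

/-! ### The measurable left inverse of the prefixing map -/

/-- **Restarting at the landing point undoes the prefixing.** If the germ of `D` at `a` fires, then
for every class `ξ` starting at `q = firePt D`,
`CurveClass.startFrom {q} (firePrefix D ξ) = ξ`: the chord visits `q` only at its final parameter
(`fireChord_eq_firePt_iff`), so this is `startFrom_concat_singleton` lifted to classes by
`CurveClass.startFrom_mk_holds`. [folklore] -/
theorem startFrom_singleton_firePrefix {D : DobrushinDomain} (h : Fires D.carrier (D.pt 0))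
    {ξ : CurveClass ℂ} (hξ : ξ.source = firePt D) :
    CurveClass.startFrom {firePt D} (firePrefix D ξ) = ξ := by
  obtain ⟨c, rfl⟩ := CurveClass.surjective_mk ξ
  rw [CurveClass.source_mk] at hξ
  -- junction and "visits `q` only at the end"
  have h1 : (fireChord D).toContinuousMap 1 = firePt D := by
    show (fireChord D).target = firePt D
    exact target_fireChord
  have hab : (fireChord D).toContinuousMap 1 = c.toContinuousMap 0 := by
    rw [h1]
    show firePt D = c.source
    rw [hξ]
  have ha : ∀ t : I, (fireChord D).toContinuousMap t = (fireChord D).toContinuousMap 1 → t = 1 := by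
    intro t ht
    rw [h1] at ht
    exact (fireChord_eq_firePt_iff h).1 ht
  rw [firePrefix_mk, mkCM, CurveClass.startFrom_mk_holds _ isClosed_singleton, ← h1,
    startFrom_concat_singleton hab ha]

/-! ### The registered stub -/

/-- **Transfer of set lower integrals along the surgery prefixing map** (stub
`stub_fatSurgeryMarkovTransfer` of line germ-label-transport): if the germ of `D` at `a` fires and
`μ`-a.e. `ξ.source = firePt D`, then for EVERY `g : CurveClass ℂ → ℝ≥0∞` (not assumed measurable)
and every measurable `T`,
`∫⁻ γ in T, g γ ∂(μ.map (firePrefix D)) = ∫⁻ ξ in firePrefix D ⁻¹' T, g (firePrefix D ξ) ∂μ`,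
by `setLIntegral_map_eq_of_ae_leftInverse` with the measurable left inverse
`CurveClass.startFrom {firePt D}` (`measurable_startFrom`, `startFrom_singleton_firePrefix`).
[folklore] -/
theorem stub_fatSurgeryMarkovTransfer : ∀ (D : DobrushinDomain) (μ : MeasureTheory.Measure (CurveClass ℂ)), Summit.CriticalPhenomena.CardyFormulaZ2.Theorems.CardyRotToConfR2SymmetryUpgrade.Negative.Fires D.carrier (D.pt 0) → (∀ᵐ ξ ∂μ, ξ.source = Summit.CriticalPhenomena.CardyFormulaZ2.Theorems.CardyRotToConfR2SymmetryUpgrade.Negative.firePt D) → ∀ (g : CurveClass ℂ → ENNReal) (T : Set (CurveClass ℂ)), MeasurableSet T → ∫⁻ γ in T, g γ ∂(μ.map (Summit.CriticalPhenomena.CardyFormulaZ2.Theorems.CardyRotToConfR2SymmetryUpgrade.Negative.firePrefix D)) = ∫⁻ ξ in Summit.CriticalPhenomena.CardyFormulaZ2.Theorems.CardyRotToConfR2SymmetryUpgrade.Negative.firePrefix D ⁻¹' T, g (Summit.CriticalPhenomena.CardyFormulaZ2.Theorems.CardyRotToConfR2SymmetryUpgrade.Negative.firePrefix D ξ) ∂μ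 := by
  intro D μ h hμ g T hT
  exact setLIntegral_map_eq_of_ae_leftInverse (measurable_firePrefix D)
    (measurable_startFrom isClosed_singleton)
    (hμ.mono fun ξ hξ => startFrom_singleton_firePrefix h hξ) g hT

end Summit.CriticalPhenomena.CardyFormulaZ2.Theorems.CardyRotToConfR2SymmetryUpgrade

end
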